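import Summits.QuantumFields.YangMills.Theorems.BalabanUVNodesN18UniformDecayOfShiftStepRate
import Summits.QuantumFields.YangMills.Theorems.BalabanUVNodesN18RunWindowEdge

/-!
# BalabanUVNodes ∕ N18 — THE (5.10) TELESCOPE ALONG THE RUN WINDOWS OF (0.20): k-UNIFORM decay of the limiting kernels INSIDE every in-window
# run, from dag-n18-w1's RUN-WINDOW kernel step rate + the level-0 row (Track A, DAG node N18 = NE5 `T4OutputRate.NE5`; cluster K4 «SpineRates»;
# key K3⁸ `SpineGivenEndpointR13SepCoPHV` = stmt-QuantumFields-27366, skeleton v6 b4e55110ab73e679; width seat `pub-ymgap-dag-n18-w4` g8, FILE 10 of the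
# seat's kernel-currency lineage (FILE 5 = p615806 `…N18UniformDecayOfStepRate`, FILE 9 = p627796 `…N18UniformDecayOfShiftStepRate`);
# `--kind proof --supports stmt-QuantumFields-27366 --as helper`, COUNT-NEUTRAL)

HONEST FRAMING.  A MECHANISM (downward telescope over the levels) in HYPOTHESIS FORM over landed definitions BY NAME.  The RUN-WINDOW step letter
(dag-n18-w1 g6 FILE 3 `…N18RunWindowEdge` p630396, hypothesis `h18run` of its `runWindowShift_of_runWindowKernelStepRate`, consumed here BYTE-FOR-BYTE as
a hypothesis SHAPE), the LEVEL-0 (5.10) row on the box (FILE 5∕9's `h0`, byte-for-byte) and the first-entry-only property (FE, FILE 9 §4's inline spelling) are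
DISPLAYED hypotheses, asserted and inhabited nowhere (A6: jointly satisfiable at model level by the zero term family; LOCATED — their content is
[Balaban1987RG1] Thm 1 p. 259 ∕ (5.10) p. 293, and NE5 is NOT PRINTED for d = 4).  Nothing of Bałaban's is asserted; N18 ∕ (D4) NOT discharged; NOT a proof of
`stub_rates13HV` ∕ `stub_expansion13HV`; K3⁸ OPEN, not claimed; counts UNMOVED (typed 28∕28 · discharged 5∕27 (A 5∕28)).  One finite four-torus programme at
fixed `ε`, Bałaban AS PRINTED; R4 closes the conditional finite-𝕋⁴ rung `BalabanLadder.UV` only — NOT ℝ⁴, NOT infinite volume, NOT OS, NOT a mass gap, NOT Clay; no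
summit statement is proved by this seat.  THEOREMS ONLY: 0 `def`, 0 `instance`, 0 `sorry`, standard axioms.

WHY.  FILE 5 derives the k-UNIFORM (5.10) rows from node N18's BOX-keyed step letter `KernelStepRate` + the level-0 row; FILE 9 re-typed that telescope for ANY
SHIFT-CLOSED set of INFINITE coupling sequences (the box; the orbit set `{g | g_{i+1} = nx g_i}` of a ONE-STEP map `nx`).  dag-n18-w1's R-N18-RUN road (FILE 3∕4,
its index v2.2 items 6–7) keys N18 instead on the SLIDING WINDOWS OF THE IN-WINDOW (0.20)-RUNS of a history-dependent β — `RGEqH n β gs ∧ Step.InInterval γ n gs`,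
windows `j + (k+1) ≤ n`, letter `|Π_{k+1}(g_{j+1}, …; z) − Π_{k+2}(g_j, g_{j+1}, …; z)| ≤ C₅θ^{k+1}e^{−κ|z|₁}` — which is the currency the K1∕K2 roads and the N19
«AtRuns» readings consume (runs of record `runFlow D g₀ K` of TUNED bare sequences).  Such runs are FINITE and HISTORY-DEPENDENT: they are not the orbits of a
one-step map (FILE 9 §3 does not apply), and they are not infinite sequences of a shift-closed set (FILE 9 §2 applies only to infinite in-window runs, which a
positive β-floor `b₀ ≤ β` — `FlowStep.BetaLowerH`, discrete asymptotic freedom — FORBIDS: by (0.20) `1∕g²` drops by `≥ b₀` per step, so a first entry `b` has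
in-window forward life `≤ (1∕b² − 1∕γ²)∕b₀`).  So the telescope has to be re-run INSIDE ONE FINITE RUN: level `k + 1` at the window starting at `g_j` against level
`k` at the window starting at `g_{j+1}`, down to level `0` at `g_{j+k+1}` — induction on `k` generalising `j`, never leaving the run.  Result: the k-UNIFORM class
`Decay510 (Π_{k+1}(g_j, …, g_{j+k}; ·)) (E₀ + C₅θ∕(1−θ)) κ` at EVERY window of EVERY in-window run, from the ONE hypothesis `h18run` that also feeds the U3 → U2
edge (FILE 3∕4) — the (5.10)∕(UD) supply of record under R-N18-RUN, read where the construction reads it (along the tuned runs).  Deliberately NOT typed (they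
would be idle at the record for the reason just given): the box row `DecayBound (EA …) (Window γ)` ∕ W1-19 `KernelDecay … (Window γ)` from run data via «every
first entry heads in-window runs of every length», and the infinite-run edition via FILE 9 §2.  What IS typed under FE is the exact pointwise extent: level-`k`
(5.10) at every box history whose first entry is READ at depth-`k` position of some in-window run (§2).

WHAT.  §1 finite in-window runs (generic term family `ℰ`): ★ `abs_kernelA_runWindow_le_of_runWindowStepRate_of_base` (THE TELESCOPE inside one run) ·
★ `decay510_runWindow_of_runWindowStepRate_of_base` (k-UNIFORM class at every run window) · `decay510_extd_runWindow_of_runWindowStepRate_of_base` (padded-window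
edition `extd (prefixOf …)`, the `extd v` form of FILE 3 §1∕§3) · `decay510_runWindow_of_kernelStepRate_of_base` (the BOX letter gives the same — FILE 3's
`runWindowKernelStepRate_of_kernelStepRate` BY NAME; the run-window currency is WEAKER than FILE 5's).  §2 first-entry-only kernels:
`decay510_of_runWindowStepRate_of_base_of_firstEntryOnly` (under FE, level-`k` (5.10) at every `g ∈ ]0, γ]^ℕ` whose first entry occurs in an in-window run
with `k` forward steps).

Sources (TYPES and the mechanism only): T. Bałaban, Commun. Math. Phys. **109** (1987) 249–301 [Balaban1987RG1] — (0.18)–(0.20) pp. 255–256 (the runs),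
Thm 1 ∕ Thm 2 p. 259 (the window `]0, γ]`; «uniform in the lattice spacing ε»), (1.18) p. 263, (1.20)–(1.22) p. 264, (5.10) p. 293; C. King, Commun. Math. Phys.
**102** (1986) 649–677 [King1986] — Lemma 4.5 (4.38) p. 674 (printed one-step sibling).  No claim about the mass gap.
-/

noncomputable section

open scoped BigOperators

namespace YMDAG.N18.UniformDecayAlongRunWindows

open Literature.MathematicalPhysics.QuantumFieldTheory.Balaban1983to89
open Literature.MathematicalPhysics.QuantumFieldTheory.Balaban1983to89.T4Continuum (T4Family)
open Literature.MathematicalPhysics.QuantumFieldTheory.Balaban1983to89.T4OutputRate (Window mem_window)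
open Literature.MathematicalPhysics.QuantumFieldTheory.Balaban1983to89.FlowStep (Box HBeta mem_box prefixOf prefixOf_apply RGEqH)
open Literature.MathematicalPhysics.QuantumFieldTheory.Balaban1983to89.T4FlagMemory (extd extd_coe)
open Literature.MathematicalPhysics.QuantumFieldTheory.Balaban1983to89.T4FlagMemoryTwoRun (extd_prefixOf)
open Literature.MathematicalPhysics.QuantumFieldTheory.Balaban1983to89.T4BetaReadOut (extd_mem_window)
open Literature.MathematicalPhysics.QuantumFieldTheory.Balaban1983to89.B12Sec2to5 (l1 l1_nonneg Decay510)
open Node00 (TermFamily1)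
open Node00.U3OfKernels (kernelA kernelA_congr)
open Node00.U3KernelLetters (KernelStepRate)
open YMDAG.N18.UniformDecayOfStepRate (sum_range_pow_succ_le)
open YMDAG.N18.RunWindowEdge (runWindowKernelStepRate_of_kernelStepRate)

section Limiting

variable {𝔄 : Type*} [NormedRing 𝔄] [NormedAlgebra ℝ 𝔄]
variable {V : Type*} [NormedAddCommGroup V] [NormedSpace ℝ V] {ι : Type*} [Fintype ι]
variable (F : T4Family) {ℰ : TermFamily1 F 𝔄} (ρ : V →L[ℝ] 𝔄) (bV : Module.Basis ι ℝ V)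

/-! ## §1 Finite in-window runs of (0.20): the telescope INSIDE one run -/

/-- ★ **THE TELESCOPE INSIDE ONE IN-WINDOW RUN.**  Hypotheses: dag-n18-w1's RUN-WINDOW KERNEL STEP RATE `h18run` (FILE 3's spelling, verbatim: for every
in-window run `RGEqH n β gs ∧ Step.InInterval γ n gs` and every window `j + (k+1) ≤ n`, `|Π_{k+1}(g_{j+1}, …; z) − Π_{k+2}(g_j, g_{j+1}, …; z)| ≤ C₅θ^{k+1}e^{−κ|z|₁}`)
and the LEVEL-0 (5.10) row on the box with constant `E₀`.  Conclusion: at EVERY window `j + k ≤ n` of every in-window run,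
`|Π_{k+1}(g_j, …, g_{j+k}; z)| ≤ (E₀ + C₅ Σ_{i<k} θ^{i+1}) e^{−κ|z|₁}` — level `k + 1` at the window starting at `g_j` against level `k` at the window starting at
`g_{j+1}`, down to level `0` at `g_{j+k}`; the induction never leaves the run (a level-`k` kernel reads `k + 1` couplings).
[cite: Balaban1987RG1, (0.18)–(0.20) pp.255–256, Thm 1 p.259 and (5.10) p.293 (mechanism; nothing of the source asserted)] -/
theorem abs_kernelA_runWindow_le_of_runWindowStepRate_of_base {β : HBeta} {γ κ θ C₅ E₀ : ℝ}
    (h18run : ∀ (n : ℕ) (gs : ℕ → ℝ), RGEqH n β gs → Step.InInterval γ n gs → ∀ j k : ℕ, j + (k + 1) ≤ n → ∀ (μ ν : Fin 4) (z : Fin 4 → ℤ),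
      |kernelA F ℰ ρ bV (fun i => gs (j + 1 + i)) k μ ν z - kernelA F ℰ ρ bV (fun i => gs (j + i)) (k + 1) μ ν z| ≤
        C₅ * θ ^ (k + 1) * Real.exp (-(κ * l1 z)))
    (h0 : ∀ g ∈ Window γ, ∀ (μ ν : Fin 4), Decay510 (kernelA F ℰ ρ bV g 0 μ ν) E₀ κ)
    {n : ℕ} {gs : ℕ → ℝ} (hR : RGEqH n β gs) (hI : Step.InInterval γ n gs)
    (k : ℕ) {j : ℕ} (hjk : j + k ≤ n) (μ ν : Fin 4) (z : Fin 4 → ℤ) :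
    |kernelA F ℰ ρ bV (fun i => gs (j + i)) k μ ν z| ≤ (E₀ + C₅ * ∑ i ∈ Finset.range k, θ ^ (i + 1)) * Real.exp (-(κ * l1 z)) := by
  induction k generalizing j with
  | zero =>
    -- level `0` reads the single coupling `g_j ∈ ]0, γ]`: transfer the box row along the constant sequence `(g_j, g_j, …)`
    have hb : 0 < gs j ∧ gs j ≤ γ := hI j (by omega)
    have hc : kernelA F ℰ ρ bV (fun i => gs (j + i)) 0 = kernelA F ℰ ρ bV (fun _ => gs j) 0 :=
      kernelA_congr F ℰ ρ bV fun i hi => by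
        have hi0 : i = 0 := by omega
        subst hi0
        simp
    have h := h0 (fun _ => gs j) (mem_window.2 fun _ => hb) μ ν z
    rw [neg_mul, ← hc] at h
    simpa using h
  | succ k ih =>
    have hstep := h18run n gs hR hI j k hjk μ ν z
    have hih := ih (j := j + 1) (by omega)
    calc |kernelA F ℰ ρ bV (fun i => gs (j + i)) (k + 1) μ ν z|
        = |kernelA F ℰ ρ bV (fun i => gs (j + 1 + i)) k μ ν z -
            (kernelA F ℰ ρ bV (fun i => gs (j + 1 + i)) k μ ν z - kernelA F ℰ ρ bV (fun i => gs (j + i)) (k + 1) μ ν z)| := by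
          congr 1; ring
      _ ≤ |kernelA F ℰ ρ bV (fun i => gs (j + 1 + i)) k μ ν z| +
            |kernelA F ℰ ρ bV (fun i => gs (j + 1 + i)) k μ ν z - kernelA F ℰ ρ bV (fun i => gs (j + i)) (k + 1) μ ν z| := abs_sub _ _
      _ ≤ (E₀ + C₅ * ∑ i ∈ Finset.range k, θ ^ (i + 1)) * Real.exp (-(κ * l1 z)) + C₅ * θ ^ (k + 1) * Real.exp (-(κ * l1 z)) :=
          add_le_add hih hstep
      _ = (E₀ + C₅ * ∑ i ∈ Finset.range (k + 1), θ ^ (i + 1)) * Real.exp (-(κ * l1 z)) := by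
          rw [Finset.sum_range_succ]; ring

/-- ★ **THE k-UNIFORM (5.10) CLASS AT EVERY RUN WINDOW**: with `0 ≤ C₅`, `0 ≤ θ < 1`, the run-window kernel step rate + the level-0 row give ONE constant
`E₀ + C₅·θ∕(1−θ)` for the kernels of EVERY level at EVERY window `j + k ≤ n` of EVERY in-window (0.20)-run — `Decay510 (Π_{k+1}(g_j, …, g_{j+k}; ·)) (E₀ + C₅θ∕(1−θ)) κ`
— the (5.10)∕(UD) row read where the construction reads it, with NO box-keyed N18 letter. [cite: Balaban1987RG1, (1.18) p.263, Thm 1 p.259 and (5.10) p.293 (mechanism; nothing of the source asserted)] -/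
theorem decay510_runWindow_of_runWindowStepRate_of_base {β : HBeta} {γ κ θ C₅ E₀ : ℝ} (hθ0 : 0 ≤ θ) (hθ1 : θ < 1) (hC₅ : 0 ≤ C₅)
    (h18run : ∀ (n : ℕ) (gs : ℕ → ℝ), RGEqH n β gs → Step.InInterval γ n gs → ∀ j k : ℕ, j + (k + 1) ≤ n → ∀ (μ ν : Fin 4) (z : Fin 4 → ℤ),
      |kernelA F ℰ ρ bV (fun i => gs (j + 1 + i)) k μ ν z - kernelA F ℰ ρ bV (fun i => gs (j + i)) (k + 1) μ ν z| ≤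
        C₅ * θ ^ (k + 1) * Real.exp (-(κ * l1 z)))
    (h0 : ∀ g ∈ Window γ, ∀ (μ ν : Fin 4), Decay510 (kernelA F ℰ ρ bV g 0 μ ν) E₀ κ)
    {n : ℕ} {gs : ℕ → ℝ} (hR : RGEqH n β gs) (hI : Step.InInterval γ n gs) {j k : ℕ} (hjk : j + k ≤ n) (μ ν : Fin 4) :
    Decay510 (kernelA F ℰ ρ bV (fun i => gs (j + i)) k μ ν) (E₀ + C₅ * (θ / (1 - θ))) κ := fun z => by
  rw [neg_mul]
  refine (abs_kernelA_runWindow_le_of_runWindowStepRate_of_base F ρ bV h18run h0 hR hI k hjk μ ν z).trans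
    (mul_le_mul_of_nonneg_right ?_ (Real.exp_pos _).le)
  exact add_le_add le_rfl (mul_le_mul_of_nonneg_left (sum_range_pow_succ_le hθ0 hθ1 k) hC₅)

/-- **PADDED-WINDOW EDITION**: the same class for the kernel at the PADDED window history `extd (g_j, …, g_{j+k})` — the `extd v`, `v ∈ Box γ k` form in
which FILE 3 §1∕§3 and `SpineRates.ReadOutAt`'s first clause present run windows (a level-`k` kernel does not read the padding).
[cite: Balaban1987RG1, §5 p.298 and (5.10) p.293 (prefix dependence; bookkeeping)] -/
theorem decay510_extd_runWindow_of_runWindowStepRate_of_base {β : HBeta} {γ κ θ C₅ E₀ : ℝ} (hθ0 : 0 ≤ θ) (hθ1 : θ < 1) (hC₅ : 0 ≤ C₅)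
    (h18run : ∀ (n : ℕ) (gs : ℕ → ℝ), RGEqH n β gs → Step.InInterval γ n gs → ∀ j k : ℕ, j + (k + 1) ≤ n → ∀ (μ ν : Fin 4) (z : Fin 4 → ℤ),
      |kernelA F ℰ ρ bV (fun i => gs (j + 1 + i)) k μ ν z - kernelA F ℰ ρ bV (fun i => gs (j + i)) (k + 1) μ ν z| ≤
        C₅ * θ ^ (k + 1) * Real.exp (-(κ * l1 z)))
    (h0 : ∀ g ∈ Window γ, ∀ (μ ν : Fin 4), Decay510 (kernelA F ℰ ρ bV g 0 μ ν) E₀ κ)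
    {n : ℕ} {gs : ℕ → ℝ} (hR : RGEqH n β gs) (hI : Step.InInterval γ n gs) {j k : ℕ} (hjk : j + k ≤ n) (μ ν : Fin 4) :
    Decay510 (kernelA F ℰ ρ bV (extd (prefixOf (fun i => gs (j + i)) k)) k μ ν) (E₀ + C₅ * (θ / (1 - θ))) κ := by
  have hc : kernelA F ℰ ρ bV (extd (prefixOf (fun i => gs (j + i)) k)) k = kernelA F ℰ ρ bV (fun i => gs (j + i)) k :=
    kernelA_congr F ℰ ρ bV fun i hi => by rw [extd_prefixOf (Nat.le_of_lt_succ hi)]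
  rw [hc]
  exact decay510_runWindow_of_runWindowStepRate_of_base F ρ bV hθ0 hθ1 hC₅ h18run h0 hR hI hjk μ ν

/-- **THE BOX LETTER GIVES THE SAME** (sanity; the run-window currency is WEAKER than FILE 5's): W1-19b's box-keyed `KernelStepRate F ℰ ρ bV γ κ θ C₅` implies
the run-window kernel step rate (dag-n18-w1's `runWindowKernelStepRate_of_kernelStepRate`, BY NAME), hence the k-uniform class at every run window.
[cite: Balaban1987RG1, Thm 1 p.259 and (5.10) p.293 (mechanism; nothing of the source asserted)] -/
theorem decay510_runWindow_of_kernelStepRate_of_base {β : HBeta} {γ κ θ C₅ E₀ : ℝ} (hθ0 : 0 ≤ θ) (hθ1 : θ < 1) (hC₅ : 0 ≤ C₅)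
    (h18 : KernelStepRate F ℰ ρ bV γ κ θ C₅) (h0 : ∀ g ∈ Window γ, ∀ (μ ν : Fin 4), Decay510 (kernelA F ℰ ρ bV g 0 μ ν) E₀ κ)
    {n : ℕ} {gs : ℕ → ℝ} (hR : RGEqH n β gs) (hI : Step.InInterval γ n gs) {j k : ℕ} (hjk : j + k ≤ n) (μ ν : Fin 4) :
    Decay510 (kernelA F ℰ ρ bV (fun i => gs (j + i)) k μ ν) (E₀ + C₅ * (θ / (1 - θ))) κ :=
  decay510_runWindow_of_runWindowStepRate_of_base F ρ bV hθ0 hθ1 hC₅ (runWindowKernelStepRate_of_kernelStepRate F ℰ ρ bV h18) h0 hR hI hjk μ ν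

/-! ## §2 First-entry-only kernels: the exact pointwise extent of the class on the box -/

/-- **UNDER FE, LEVEL-`k` (5.10) AT EVERY BOX HISTORY WHOSE FIRST ENTRY IS READ `k` STEPS DEEP IN SOME IN-WINDOW RUN.**  If the limiting kernels are
FIRST-ENTRY-ONLY on the box (the DISPLAYED hypothesis `hFE`, FILE 9 §4's spelling) then for every `g ∈ ]0, γ]^ℕ` with `g 0 = g_j` for an in-window run `gs` and a
window `j + k ≤ n`, `Decay510 (Π_{k+1}(g; ·)) (E₀ + C₅θ∕(1−θ)) κ`.  (The set-level box row would need in-window runs of EVERY length from EVERY first entry, which a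
positive β-floor forbids at the record — see the module docstring; this pointwise form is what survives.)
[cite: Balaban1987RG1, Thm 1 ∕ Thm 2 p.259, (1.18) p.263 and (5.10) p.293 (bookkeeping; FE ∕ NE5 NOT asserted)] -/
theorem decay510_of_runWindowStepRate_of_base_of_firstEntryOnly {β : HBeta} {γ κ θ C₅ E₀ : ℝ} (hθ0 : 0 ≤ θ) (hθ1 : θ < 1) (hC₅ : 0 ≤ C₅)
    (h18run : ∀ (n : ℕ) (gs : ℕ → ℝ), RGEqH n β gs → Step.InInterval γ n gs → ∀ j k : ℕ, j + (k + 1) ≤ n → ∀ (μ ν : Fin 4) (z : Fin 4 → ℤ),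
      |kernelA F ℰ ρ bV (fun i => gs (j + 1 + i)) k μ ν z - kernelA F ℰ ρ bV (fun i => gs (j + i)) (k + 1) μ ν z| ≤
        C₅ * θ ^ (k + 1) * Real.exp (-(κ * l1 z)))
    (h0 : ∀ g ∈ Window γ, ∀ (μ ν : Fin 4), Decay510 (kernelA F ℰ ρ bV g 0 μ ν) E₀ κ)
    (hFE : ∀ g ∈ Window γ, ∀ g' ∈ Window γ, g 0 = g' 0 → ∀ (k : ℕ) (μ ν : Fin 4) (z : Fin 4 → ℤ),
      kernelA F ℰ ρ bV g k μ ν z = kernelA F ℰ ρ bV g' k μ ν z)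
    {n : ℕ} {gs : ℕ → ℝ} (hR : RGEqH n β gs) (hI : Step.InInterval γ n gs) {j k : ℕ} (hjk : j + k ≤ n)
    {g : ℕ → ℝ} (hg : g ∈ Window γ) (hg0 : g 0 = gs j) (μ ν : Fin 4) :
    Decay510 (kernelA F ℰ ρ bV g k μ ν) (E₀ + C₅ * (θ / (1 - θ))) κ := fun z => by
  -- the padded window history `extd (g_j, …, g_{j+k})` is a box sequence with the same first entry as `g`
  have hbox : prefixOf (fun i => gs (j + i)) k ∈ Box γ k := mem_box.mpr fun i => hI (j + i) (by have := i.isLt; omega)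
  have hg' : extd (prefixOf (fun i => gs (j + i)) k) ∈ Window γ := extd_mem_window hbox
  have h0' : g 0 = extd (prefixOf (fun i => gs (j + i)) k) 0 := by
    rw [extd_prefixOf (Nat.zero_le k), hg0]
    simp
  rw [hFE g hg _ hg' h0' k μ ν z]
  exact decay510_extd_runWindow_of_runWindowStepRate_of_base F ρ bV hθ0 hθ1 hC₅ h18run h0 hR hI hjk μ ν z

end Limiting

end YMDAG.N18.UniformDecayAlongRunWindows
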